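import Summits.ABC.StewartYu.PadicW80ParD
import Literature.NumberTheory.Transcendental.Waldschmidt1980SizeHyp
import HarnessLib

/-!
# Cell abc-stewartyu, WP-A4/J2: the archimedean sizes at the `p`-adic parameter record, I

`Summits/ABC/StewartYu/PadicW80Sizes.lean` — cell `abc-stewartyu` (HOME
`run/shared/lean/pub/abc-stewartyu/`, seat p3; theorems only, no named fact), on top of p1's
parameter record `Summit.ABC.StewartYu.PadicW80Par` (`PadicW80Par{,B,C,D}.lean`: `Up, 𝔘p, 𝔅p, Tp,
hparp, Lbp, S₀p, Lp, Lθp, J₀p, Xptp, Vallp, Lallp, tJp`) and p2's record-free height link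
`CW77.Setup.SizeHyp S V Vθ W` (`Waldschmidt1980SizeHyp.lean`).

This file and `PadicW80SizesB/C.lean` re-derive, for a sign-free `S : CW77.Setup` under
`hy : S.SizeHyp P.Vs P.Vel P.Wb`, the ARCHIMEDEAN size estimates of Waldschmidt 1980 §3.3–3.4 at the
`p`-adic parameters (moderate powers `≤ e^{𝔘/256}` / `≤ 𝔅`; height factors `≤ exp(c·𝔘/(2c_L'))`);
proofs as in the tree's `Waldschmidt1980Sizes(B).lean` with p1's parameter lemmas substituted.

Everything is [folklore] book-keeping on [cite: Waldschmidt1980, §3.3–3.4 (pp. 268–270)].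
-/

noncomputable section

open Finset Real
open Literature.NumberTheory.Transcendental
open Literature.NumberTheory.Transcendental.Baker1975
open Literature.NumberTheory.Transcendental.Baker1975.Ch3
open Literature.NumberTheory.Transcendental.CW77

namespace Summit.ABC.StewartYu

namespace PadicW80Par

variable {d : ℕ} (P : PadicW80Par d)

/-! ### Moderate powers of the parameters -/

/-- Products of quantities `≤ 𝔅ⁱ`. [folklore] -/
theorem mul_le_𝔅_pow_p {a b : ℝ} {i j : ℕ} (ha : a ≤ P.𝔅p ^ i) (hb : b ≤ P.𝔅p ^ j) (hb0 : 0 ≤ b) :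
    a * b ≤ P.𝔅p ^ (i + j) := by
  rw [pow_add]
  have h𝔅 := P.𝔅_pos
  calc a * b ≤ P.𝔅p ^ i * b := mul_le_mul_of_nonneg_right ha hb0
    _ ≤ P.𝔅p ^ i * P.𝔅p ^ j := mul_le_mul_of_nonneg_left hb (by positivity)

/-- `2⁹⁰ m W⋆ ≤ 𝔘`. [folklore] -/
theorem mW_le_𝔘_p : (2 : ℝ) ^ 90 * (mRp d * P.Wstarp) ≤ P.𝔘p := by
  have h := P.𝔘_ge
  have hG := P.one_le_G; have hV := P.one_le_prodV; have hVθ := P.one_le_Vθ; have hW := P.one_le_Wstar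
  have hm2 : mRp d ≤ 2 ^ (d + 1) := by
    unfold mRp
    have : ((d : ℝ) + 1) = ((d + 1 : ℕ) : ℝ) := by push_cast; ring
    rw [this]; exact_mod_cast (Nat.lt_two_pow_self).le
  have hd := P.hd
  have hpow : (2 : ℝ) ^ 90 * mRp d ≤ 2 ^ (49 * (d + 1)) := by
    calc (2 : ℝ) ^ 90 * mRp d ≤ 2 ^ 90 * 2 ^ (d + 1) := by gcongr
      _ = 2 ^ (91 + d) := by rw [← pow_add]; ring_nf
      _ ≤ 2 ^ (49 * (d + 1)) := pow_le_pow_right₀ (by norm_num) (by omega)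
  have hVV : 1 ≤ (∏ j, P.Vs j) * P.Vel := by nlinarith
  calc (2 : ℝ) ^ 90 * (mRp d * P.Wstarp) = (2 ^ 90 * mRp d) * P.Wstarp := by ring
    _ ≤ 2 ^ (49 * (d + 1)) * P.Wstarp := by gcongr
    _ = 2 ^ (49 * (d + 1)) * 1 * 1 * P.Wstarp := by ring
    _ ≤ 2 ^ (49 * (d + 1)) * P.Gp * ((∏ j, P.Vs j) * P.Vel) * P.Wstarp := by
        have h49 : (0 : ℝ) ≤ 2 ^ (49 * (d + 1)) := pow_nonneg zero_le_two _
        have hG0 : 0 ≤ P.Gp := by linarith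
        exact mul_le_mul_of_nonneg_right
          (mul_le_mul (mul_le_mul_of_nonneg_left hG h49) hVV zero_le_one (mul_nonneg h49 hG0)) (by linarith)
    _ ≤ P.𝔘p := h

/-- `T^T ≤ exp(𝔘/256)`. [folklore] -/
theorem T_pow_T_le_p : (P.Tp : ℝ) ^ P.Tp ≤ Real.exp (P.𝔘p / 256) := by
  have hT := P.T_pos
  rw [← Real.exp_log hT, ← Real.exp_nat_mul, Real.exp_le_exp]
  have h1 := P.log_T_le; have h2 := P.TWstar_le; have hU := P.𝔘_pos
  calc (P.Tp : ℝ) * Real.log P.Tp ≤ P.Tp * (10 * P.Wstarp) := mul_le_mul_of_nonneg_left h1 hT.le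
    _ = 10 * (P.Tp * P.Wstarp) := by ring
    _ ≤ 10 * (P.𝔘p / cTp) := by gcongr
    _ ≤ P.𝔘p / 256 := by unfold cTp; nlinarith

/-- `T^k ≤ exp(𝔘/256)` for `k ≤ T`. [folklore] -/
theorem T_pow_le_p {k : ℕ} (hk : k ≤ P.Tp) : (P.Tp : ℝ) ^ k ≤ Real.exp (P.𝔘p / 256) := by
  have h1 : (1 : ℝ) ≤ P.Tp := by exact_mod_cast P.one_le_T
  exact (pow_le_pow_right₀ h1 hk).trans P.T_pow_T_le_p

/-- `2^{h L_b} ≤ exp(𝔘/256)`. [folklore] -/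
theorem two_pow_hLb_le_p : (2 : ℝ) ^ (P.hparp * P.Lbp) ≤ Real.exp (P.𝔘p / 256) := by
  have h2 : (2 : ℝ) = Real.exp (Real.log 2) := (Real.exp_log two_pos).symm
  rw [h2, ← Real.exp_nat_mul, Real.exp_le_exp]
  push_cast
  have h1 := P.hparLb_le; have hW := P.Wstar_le_𝔘; have hU := P.𝔘_pos
  have hl2 : Real.log 2 ≤ 1 := by linarith [Real.log_two_lt_d9]
  have hl0 : 0 ≤ Real.log 2 := Real.log_nonneg one_le_two
  have h0 : (0 : ℝ) ≤ P.hparp * P.Lbp := by positivity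
  calc ((P.hparp : ℝ) * P.Lbp) * Real.log 2 ≤ (P.hparp * P.Lbp) * 1 := mul_le_mul_of_nonneg_left hl2 h0
    _ ≤ P.𝔘p / cLp + 3 * P.Wstarp := by linarith
    _ ≤ P.𝔘p / 256 := by unfold cLp; nlinarith

/-- `exp(𝔘/256)⁴ = 𝔅`. [folklore] -/
theorem exp_quarter_pow_four_p : Real.exp (P.𝔘p / 256) ^ 4 = P.𝔅p := by
  unfold 𝔅p; rw [← Real.exp_nat_mul]; ring_nf

/-- **`(e(x+h)/h)^{h L_b} ≤ exp(𝔘/256)`** for `x ≤ Xpt`. [cite: Waldschmidt1980, (3.13)–(3.14) (p. 265)] -/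
theorem ratio_pow_le_p {x : ℕ} (hx : (x : ℝ) ≤ P.Xptp) :
    (Real.exp 1 * ((x : ℝ) + P.hparp) / P.hparp) ^ (P.hparp * P.Lbp) ≤ Real.exp (P.𝔘p / 256) := by
  have hh := P.hpar_pos
  have hbase : 1 ≤ Real.exp 1 * ((x : ℝ) + P.hparp) / P.hparp := by
    rw [le_div_iff₀ hh]
    have := Real.exp_one_gt_two; have := Nat.cast_nonneg (α := ℝ) x
    nlinarith
  have hpos : 0 < Real.exp 1 * ((x : ℝ) + P.hparp) / P.hparp := by linarith
  rw [← Real.exp_log hpos, ← Real.exp_nat_mul, Real.exp_le_exp]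
  have h1 : Real.log (Real.exp 1 * ((x : ℝ) + P.hparp) / P.hparp) =
      1 + Real.log (((x : ℝ) + P.hparp) / P.hparp) := by
    rw [mul_div_assoc, Real.log_mul (Real.exp_pos 1).ne' (by positivity), Real.log_exp]
  rw [h1]
  have h2 : Real.log (((x : ℝ) + P.hparp) / P.hparp) ≤ 6 * P.Gp := by
    refine le_trans (Real.log_le_log (by positivity) ?_) P.log_Xpt_div_le
    exact div_le_div_of_nonneg_right (by linarith) hh.le
  have hG := P.one_le_G
  have h3 := P.hparLbG_le; have hW := P.Wstar_le_𝔘; have hGU := P.G_le_𝔘; have hU := P.𝔘_pos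
  have h0 : (0 : ℝ) ≤ P.hparp * P.Lbp := by positivity
  push_cast
  calc ((P.hparp : ℝ) * P.Lbp) * (1 + Real.log (((x : ℝ) + P.hparp) / P.hparp))
      ≤ (P.hparp * P.Lbp) * (7 * P.Gp) := mul_le_mul_of_nonneg_left (by linarith) h0
    _ = 7 * (P.hparp * P.Lbp * P.Gp) := by ring
    _ ≤ 7 * (P.𝔘p / cLp + (P.Wstarp + P.Gp)) := by gcongr
    _ ≤ P.𝔘p / 256 := by unfold cLp; nlinarith

/-- **`ν(x, h)^k ≤ 𝔅`** for `x ≤ Xpt`, `k ≤ T`. [cite: Waldschmidt1980, §3.4 (3.21) (p. 269)] -/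
theorem nuBound_pow_le_𝔅_p {x k : ℕ} (hx : (x : ℝ) ≤ P.Xptp) (hk : k ≤ P.Tp) :
    ((nuBound x P.hparp : ℕ) : ℝ) ^ k ≤ P.𝔅p := by
  have hν1 : (1 : ℝ) ≤ nuBound x P.hparp := by exact_mod_cast nuBound_pos x P.hparp
  refine (pow_le_pow_right₀ hν1 hk).trans (P.le_𝔅_of_log_le ?_)
  rw [Real.log_pow]
  have h1 := Waldschmidt1980.W80Par.log_nuBound_le_one_le (x := x) P.one_le_hpar
  have hh := P.hpar_pos
  have h2 : Real.log (((x : ℝ) + P.hparp) / P.hparp) ≤ 6 * P.Gp := by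
    refine le_trans (Real.log_le_log (by positivity) ?_) P.log_Xpt_div_le
    exact div_le_div_of_nonneg_right (by linarith) hh.le
  have hG := P.one_le_G
  have h3 : Real.log (nuBound x P.hparp) ≤ P.hparp * (60 * P.Gp) := by
    refine h1.trans (mul_le_mul_of_nonneg_left ?_ hh.le)
    linarith
  have hT := P.T_pos; have hTW := P.TWstar_le; have hGW := P.G_le_two_Wstar; have hhG := P.hparG_le
  have hU := P.𝔘_pos
  calc (P.Tp : ℝ) * Real.log (nuBound x P.hparp) ≤ P.Tp * (P.hparp * (60 * P.Gp)) :=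
        mul_le_mul_of_nonneg_left h3 hT.le
    _ = 60 * P.Tp * (P.hparp * P.Gp) := by ring
    _ ≤ 60 * P.Tp * (P.Wstarp + P.Gp) := by gcongr
    _ ≤ 60 * P.Tp * (3 * P.Wstarp) := by gcongr; linarith
    _ = 180 * (P.Tp * P.Wstarp) := by ring
    _ ≤ 180 * (P.𝔘p / cTp) := by gcongr
    _ ≤ P.𝔘p / 64 := by unfold cTp; nlinarith

/-! ### The linear-form constant `Γ = 2 U e^W` and the ranges against `U` -/

/-- `log(2 U e^W) ≤ 11 W⋆ + 1`. [folklore] -/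
theorem log_Γ_le_p : Real.log (2 * P.Up * Real.exp P.Wb) ≤ 11 * P.Wstarp + 1 := by
  have hU := P.U_pos
  rw [Real.log_mul (by positivity) (Real.exp_pos _).ne', Real.log_mul (by norm_num) hU.ne', Real.log_exp]
  have h1 := P.log_U_le; have h2 := P.W_le_Wstar
  have h3 : Real.log 2 ≤ 1 := by have := Real.log_two_lt_d9; linarith
  linarith

/-- `1 ≤ 2 U e^W`. [folklore] -/
theorem one_le_Γ_p : (1 : ℝ) ≤ 2 * P.Up * Real.exp P.Wb := by
  have hW : 1 ≤ Real.exp P.Wb := Real.one_le_exp (by linarith [P.hW])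
  have hU : 1 ≤ P.Up := by
    have := P.U_div_ge'; have hW1 := P.one_le_Wstar
    have h2 : (1 : ℝ) ≤ 2 ^ (49 * (d + 1)) := one_le_pow₀ (by norm_num)
    have h3 : P.Up / (2 ^ (d + 1) * P.Wstarp) ≤ P.Up := div_le_self P.U_pos.le (by
      have : (1 : ℝ) ≤ 2 ^ (d + 1) := one_le_pow₀ (by norm_num)
      nlinarith)
    linarith
  nlinarith

/-- `Lⱼ ≤ U`. [cite: Waldschmidt1980, (3.4) (p. 264)] -/
theorem Lp_le_U (j : Fin d) : (P.Lp j : ℝ) ≤ P.Up := by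
  have hU := P.U_pos
  have hden : 1 ≤ cLp' * mRp d * 2 ^ (d + 2) * P.S₀p * P.Vs j := by
    have hm := two_le_mR P; have hS : (2 : ℝ) ≤ P.S₀p := by exact_mod_cast P.two_le_S₀
    have hV := P.hV j
    have h4 : (1 : ℝ) ≤ 2 ^ (d + 2) := one_le_pow₀ (by norm_num)
    unfold cLp'
    have h5 : (1 : ℝ) ≤ 2 ^ 12 * mRp d := by nlinarith
    calc (1 : ℝ) ≤ 2 ^ 12 * mRp d := h5
      _ ≤ 2 ^ 12 * mRp d * 2 ^ (d + 2) := le_mul_of_one_le_right (by positivity) h4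
      _ ≤ 2 ^ 12 * mRp d * 2 ^ (d + 2) * P.S₀p := le_mul_of_one_le_right (by positivity) (by linarith)
      _ ≤ 2 ^ 12 * mRp d * 2 ^ (d + 2) * P.S₀p * P.Vs j := le_mul_of_one_le_right (by positivity) hV
  unfold Lp
  calc (⌊P.Up / (cLp' * mRp d * 2 ^ (d + 2) * P.S₀p * P.Vs j)⌋₊ : ℝ)
      ≤ P.Up / (cLp' * mRp d * 2 ^ (d + 2) * P.S₀p * P.Vs j) := Nat.floor_le (by positivity)
    _ ≤ P.Up := div_le_self hU.le hden

/-- `L_θ ≤ U`. [cite: Waldschmidt1980, (3.4) (p. 264)] -/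
theorem Lθp_le_U : (P.Lθp : ℝ) ≤ P.Up := by
  have hU := P.U_pos
  have hden : 1 ≤ cLp' * mRp d * 2 ^ (d + 2) * P.S₀p * P.Vel := by
    have hm := two_le_mR P; have hS : (2 : ℝ) ≤ P.S₀p := by exact_mod_cast P.two_le_S₀
    have hV := P.one_le_Vθ
    have h4 : (1 : ℝ) ≤ 2 ^ (d + 2) := one_le_pow₀ (by norm_num)
    unfold cLp'
    have h5 : (1 : ℝ) ≤ 2 ^ 12 * mRp d := by nlinarith
    calc (1 : ℝ) ≤ 2 ^ 12 * mRp d := h5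
      _ ≤ 2 ^ 12 * mRp d * 2 ^ (d + 2) := le_mul_of_one_le_right (by positivity) h4
      _ ≤ 2 ^ 12 * mRp d * 2 ^ (d + 2) * P.S₀p := le_mul_of_one_le_right (by positivity) (by linarith)
      _ ≤ 2 ^ 12 * mRp d * 2 ^ (d + 2) * P.S₀p * P.Vel := le_mul_of_one_le_right (by positivity) hV
  exact P.Lθ_le.trans (div_le_self hU.le hden)

/-- `Lallᵢ ≤ U`. [cite: Waldschmidt1980, (3.4) (p. 264)] -/
theorem Lallp_le_U (i : Fin (d + 1)) : (P.Lallp i : ℝ) ≤ P.Up := by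
  refine Fin.lastCases ?_ (fun j => ?_) i
  · rw [P.Lall_last]; exact P.Lθp_le_U
  · rw [P.Lall_castSucc]; exact P.Lp_le_U j

/-- `∑ᵢ Lallᵢ Vallᵢ = ∑ⱼ LⱼVⱼ + L_θ V_θ`. [folklore] -/
theorem sum_Lallp_Vallp : ∑ i, (P.Lallp i : ℝ) * P.Vallp i = (∑ j, (P.Lp j : ℝ) * P.Vs j) + P.Lθp * P.Vel := by
  rw [Fin.sum_univ_castSucc]; simp

/-- **`S₀ ∑ᵢ Lallᵢ Vallᵢ ≤ 𝔘/(2c_L')`** ((3.11) at the `p`-adic parameters). [cite: Waldschmidt1980, (3.11) (p. 265)] -/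
theorem S₀p_sum_LV_le : (P.S₀p : ℝ) * ∑ i, (P.Lallp i : ℝ) * P.Vallp i ≤ P.𝔘p / (2 * cLp') := by
  rw [P.sum_Lallp_Vallp]; exact P.S₀LV_le

/-- **`∑ eᵢ Vallᵢ ≤ c 𝔘/(2c_L')`** when `eᵢ ≤ c Lallᵢ S₀`. [cite: Waldschmidt1980, (3.11) (p. 265)] -/
theorem sum_eVp_le {e : Fin (d + 1) → ℕ} {c : ℕ} (he : ∀ i, e i ≤ c * P.Lallp i * P.S₀p) :
    ∑ i, (e i : ℝ) * P.Vallp i ≤ c * (P.𝔘p / (2 * cLp')) := by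
  have h1 : ∑ i, (e i : ℝ) * P.Vallp i ≤ c * (P.S₀p * ∑ i, (P.Lallp i : ℝ) * P.Vallp i) := by
    rw [mul_sum, mul_sum]
    refine sum_le_sum fun i _ => ?_
    have : (e i : ℝ) ≤ c * P.Lallp i * P.S₀p := by exact_mod_cast he i
    have hV := (P.Vall_pos i).le
    calc (e i : ℝ) * P.Vallp i ≤ (c * P.Lallp i * P.S₀p) * P.Vallp i := mul_le_mul_of_nonneg_right this hV
      _ = c * (P.S₀p * ((P.Lallp i : ℝ) * P.Vallp i)) := by ring
  exact h1.trans (mul_le_mul_of_nonneg_left P.S₀p_sum_LV_le (Nat.cast_nonneg _))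

end PadicW80Par

end Summit.ABC.StewartYu

namespace Literature.NumberTheory.Transcendental.CW77

namespace Setup

open Summit.ABC.StewartYu
open Summit.ABC.StewartYu.PadicW80Par (cLp' cTp mRp)

variable {S : Setup} {P : PadicW80Par S.d} (hy : S.SizeHyp P.Vs P.Vel P.Wb)
include hy

/-! ### Coefficients -/

/-- **`|b_θ|^k ≤ 𝔅`** for `k ≤ T` (`k W ≤ T W⋆ ≤ 𝔘/c_T`). [cite: Waldschmidt1980, §3.3 (p. 268)] -/
theorem SizeHyp.natAbs_bθ_pow_le_p {k : ℕ} (hk : k ≤ P.Tp) : ((S.bθ.natAbs ^ k : ℕ) : ℝ) ≤ P.𝔅p := by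
  refine (hy.natAbs_bθ_pow_le_exp k).trans (P.exp_le_𝔅 ?_)
  have hTW := P.TWstar_le; have hW := P.W_le_Wstar; have hT := P.T_pos; have hU := P.𝔘_pos
  have hW1 := P.hW
  have hk' : (k : ℝ) ≤ P.Tp := by exact_mod_cast hk
  calc (k : ℝ) * P.Wb ≤ P.Tp * P.Wstarp := mul_le_mul hk' hW (by linarith) hT.le
    _ ≤ P.𝔘p / cTp := hTW
    _ ≤ P.𝔘p / 64 := by unfold cTp; rw [div_le_div_iff₀ (by norm_num) (by norm_num)]; nlinarith

/-! ### The linear-form factor `qA` on the boxes of the `p`-adic ranges -/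

/-- `|γⱼ(u)| ≤ 2 U e^W` on the box of level `J`. [cite: Waldschmidt1980, §3.3 (p. 268)] -/
theorem SizeHyp.abs_γ_le_p {J : ℕ} {u : Idx S.d P.hparp P.Lbp}
    (hu : u ∈ S.box (h := P.hparp) (Lb := P.Lbp) P.Lp P.Lθp J) (j : Fin S.d) :
    |(S.γ u j : ℝ)| ≤ 2 * P.Up * Real.exp P.Wb := by
  rw [S.mem_box] at hu
  unfold γ
  push_cast
  have h1 : (u.2.1 j : ℝ) ≤ P.Up := by
    have : (u.2.1 j : ℝ) ≤ P.Lp j := by exact_mod_cast (hu.1 j).trans (Nat.div_le_self _ _)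
    exact this.trans (P.Lp_le_U j)
  have h2 : (u.2.2 : ℝ) ≤ P.Up := by
    have : (u.2.2 : ℝ) ≤ P.Lθp := by exact_mod_cast hu.2.trans (Nat.div_le_self _ _)
    exact this.trans P.Lθp_le_U
  have hW : 1 ≤ Real.exp P.Wb := Real.one_le_exp (by linarith [P.hW])
  have hU := P.U_pos
  calc |(u.2.1 j : ℝ) + (u.2.2 : ℝ) * (S.β j : ℝ)| ≤ |(u.2.1 j : ℝ)| + |(u.2.2 : ℝ) * (S.β j : ℝ)| :=
        abs_add_le _ _
    _ = (u.2.1 j : ℝ) + (u.2.2 : ℝ) * |(S.β j : ℝ)| := by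
        rw [abs_mul, Nat.abs_cast, Nat.abs_cast]
    _ ≤ P.Up + P.Up * Real.exp P.Wb := add_le_add h1 (mul_le_mul h2 (hy.abs_β_le j) (abs_nonneg _) hU.le)
    _ ≤ 2 * P.Up * Real.exp P.Wb := by nlinarith

/-- **`|qA(u, τ')| ≤ 𝔅`** on the box of the `p`-adic ranges, `|τ'| ≤ T`.
[cite: Waldschmidt1980, §3.3 (proof of Lemma 3.3, p. 268)] -/
theorem SizeHyp.abs_qA_le_p {J : ℕ} {u : Idx S.d P.hparp P.Lbp}
    (hu : u ∈ S.box (h := P.hparp) (Lb := P.Lbp) P.Lp P.Lθp J)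
    {τ' : Fin S.d → ℕ} (hτ : ∑ j, τ' j ≤ P.Tp) : |(S.qA u τ' : ℝ)| ≤ P.𝔅p := by
  set Γ := 2 * P.Up * Real.exp P.Wb with hΓ
  have hΓ1 : 1 ≤ Γ := P.one_le_Γ_p
  have h1 : |(S.qA u τ' : ℝ)| ≤ Γ ^ P.Tp := by
    unfold qA; push_cast
    rw [abs_prod]
    calc ∏ j, |(S.γ u j : ℝ) ^ τ' j| = ∏ j, |(S.γ u j : ℝ)| ^ τ' j := prod_congr rfl fun j _ => abs_pow _ _
      _ ≤ ∏ j, Γ ^ τ' j := prod_le_prod (fun j _ => by positivity)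
          fun j _ => pow_le_pow_left₀ (abs_nonneg _) (hy.abs_γ_le_p hu j) _
      _ = Γ ^ ∑ j, τ' j := (prod_pow_eq_pow_sum _ _ _)
      _ ≤ Γ ^ P.Tp := pow_le_pow_right₀ hΓ1 hτ
  refine h1.trans (P.le_𝔅_of_log_le ?_)
  rw [Real.log_pow]
  have hT := P.T_pos; have hTW := P.TWstar_le; have hTU := P.T_le_𝔘; have hW := P.one_le_Wstar
  calc (P.Tp : ℝ) * Real.log Γ ≤ P.Tp * (11 * P.Wstarp + 1) := mul_le_mul_of_nonneg_left P.log_Γ_le_p hT.le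
    _ = 11 * (P.Tp * P.Wstarp) + P.Tp := by ring
    _ ≤ 11 * (P.𝔘p / cTp) + P.𝔘p / cTp := by gcongr
    _ ≤ P.𝔘p / 64 := by unfold cTp; have := P.𝔘_pos; nlinarith

/-! ### Height factors at the `p`-adic ranges -/

/-- **`∏ H(allᵢ)^{eᵢ} ≤ exp(c 𝔘/(2c_L'))`** when `eᵢ ≤ c Lallᵢ S₀`. [cite: Waldschmidt1980, (3.11) (p. 265)] -/
theorem SizeHyp.prod_hgt_pow_le_p {e : Fin (S.d + 1) → ℕ} {c : ℕ} (he : ∀ i, e i ≤ c * P.Lallp i * P.S₀p) :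
    ∏ i, hgt (S.all i) ^ e i ≤ Real.exp (c * (P.𝔘p / (2 * cLp'))) := by
  calc ∏ i, hgt (S.all i) ^ e i ≤ ∏ i, Real.exp (e i * P.Vallp i) :=
        prod_le_prod (fun i _ => pow_nonneg (hgt_pos _).le _) fun i _ => hy.hgt_pow_le i (e i)
    _ = Real.exp (∑ i, (e i : ℝ) * P.Vallp i) := (Real.exp_sum _ _).symm
    _ ≤ Real.exp (c * (P.𝔘p / (2 * cLp'))) := Real.exp_le_exp.mpr (P.sum_eVp_le he)

/-- **The denominators `∏ den(αⱼ)^{eⱼ} · den θ^{e_θ} ≤ exp(c 𝔘/(2c_L'))`** when `eⱼ ≤ c Lⱼ S₀`,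
`e_θ ≤ c L_θ S₀`. [cite: Waldschmidt1980, (3.11) (p. 265)] -/
theorem SizeHyp.den_prod_le_p {e : Fin S.d → ℕ} {eθ : ℕ} {c : ℕ} (he : ∀ j, e j ≤ c * P.Lp j * P.S₀p)
    (heθ : eθ ≤ c * P.Lθp * P.S₀p) :
    (((∏ j, (S.α j).den ^ e j) * S.θ.den ^ eθ : ℕ) : ℝ) ≤ Real.exp (c * (P.𝔘p / (2 * cLp'))) := by
  set e' : Fin (S.d + 1) → ℕ := Fin.snoc e eθ with he'
  have hall : (((∏ j, (S.α j).den ^ e j) * S.θ.den ^ eθ : ℕ) : ℝ) = ∏ i, ((S.all i).den : ℝ) ^ e' i := by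
    push_cast
    rw [Fin.prod_univ_castSucc]
    unfold all
    simp only [he', Fin.snoc_castSucc, Fin.snoc_last]
  rw [hall]
  have he'' : ∀ i, e' i ≤ c * P.Lallp i * P.S₀p := by
    intro i
    refine Fin.lastCases ?_ (fun j => ?_) i
    · simp only [he', Fin.snoc_last, PadicW80Par.Lall_last]; exact heθ
    · simp only [he', Fin.snoc_castSucc, PadicW80Par.Lall_castSucc]; exact he j
  refine le_trans ?_ (hy.prod_hgt_pow_le_p he'')
  refine prod_le_prod (fun i _ => by positivity) fun i _ => ?_
  exact pow_le_pow_left₀ (by positivity) (den_le_hgt _) _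

omit hy in
/-- The exponents on the box of level `J` at a point `s ≤ 2^J · c · S₀` are `≤ c Lallᵢ S₀`. [folklore] -/
theorem expn_le_of_mem_box_p {J c : ℕ} {u : Idx S.d P.hparp P.Lbp}
    (hu : u ∈ S.box (h := P.hparp) (Lb := P.Lbp) P.Lp P.Lθp J) {s : ℕ} (hs : s ≤ 2 ^ J * (c * P.S₀p))
    (i : Fin (S.d + 1)) : S.expn u s i ≤ c * P.Lallp i * P.S₀p := by
  rw [S.mem_box] at hu
  have hdiv : ∀ (lam Lq : ℕ), lam ≤ Lq / 2 ^ J → lam * s ≤ c * Lq * P.S₀p := by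
    intro lam Lq hl
    calc lam * s ≤ (Lq / 2 ^ J) * (2 ^ J * (c * P.S₀p)) := Nat.mul_le_mul hl hs
      _ = ((Lq / 2 ^ J) * 2 ^ J) * (c * P.S₀p) := by ring
      _ ≤ Lq * (c * P.S₀p) := Nat.mul_le_mul_right _ (Nat.div_mul_le_self Lq (2 ^ J))
      _ = c * Lq * P.S₀p := by ring
  refine Fin.lastCases ?_ (fun j => ?_) i
  · rw [S.expn_last, PadicW80Par.Lall_last]; exact hdiv _ _ hu.2
  · rw [S.expn_castSucc, PadicW80Par.Lall_castSucc]; exact hdiv _ _ (hu.1 j)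

/-- **`|qE(u, s)| ≤ exp(c 𝔘/(2c_L'))`** on the box of level `J`, `s ≤ 2^J c S₀`.
[cite: Waldschmidt1980, §3.4 (3.21) (p. 269)] -/
theorem SizeHyp.abs_qE_le_p {J c : ℕ} {u : Idx S.d P.hparp P.Lbp}
    (hu : u ∈ S.box (h := P.hparp) (Lb := P.Lbp) P.Lp P.Lθp J)
    {s : ℕ} (hs : s ≤ 2 ^ J * (c * P.S₀p)) : |(S.qE u s : ℝ)| ≤ Real.exp (c * (P.𝔘p / (2 * cLp'))) := by
  have he := S.expn_le_of_mem_box_p (P := P) hu hs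
  unfold qE; push_cast
  rw [abs_of_nonneg (by
    refine mul_nonneg (prod_nonneg fun j _ => pow_nonneg ?_ _) (pow_nonneg ?_ _)
    · exact_mod_cast (S.α_pos j).le
    · exact_mod_cast S.θ_pos.le)]
  have hall : (∏ j, (S.α j : ℝ) ^ (u.2.1 j * s)) * (S.θ : ℝ) ^ (u.2.2 * s) =
      ∏ i, ((S.all i : ℚ) : ℝ) ^ S.expn u s i := by
    rw [Fin.prod_univ_castSucc]
    unfold all
    simp only [S.expn_castSucc, S.expn_last, Fin.snoc_castSucc, Fin.snoc_last]
  rw [hall]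
  have key := hy.prod_hgt_pow_le_p he
  refine le_trans ?_ key
  refine prod_le_prod (fun i _ => pow_nonneg (by exact_mod_cast (S.all_pos i).le) _) fun i _ => ?_
  exact pow_le_pow_left₀ (by exact_mod_cast (S.all_pos i).le) (self_le_hgt _) _

/-- **`|qEh(u, s)| ≤ exp(c 𝔘/(2c_L'))`** on the box of level `J`, `s ≤ 2^J c S₀` (the half-point
factor). [cite: Waldschmidt1980, §3.4 (3.22) (p. 270)] -/
theorem SizeHyp.abs_qEh_le_p {J c : ℕ} {u : Idx S.d P.hparp P.Lbp}
    (hu : u ∈ S.box (h := P.hparp) (Lb := P.Lbp) P.Lp P.Lθp J)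
    {s : ℕ} (hs : s ≤ 2 ^ J * (c * P.S₀p)) : |(S.qEh u s : ℝ)| ≤ Real.exp (c * (P.𝔘p / (2 * cLp'))) := by
  have he := S.expn_le_of_mem_box_p (P := P) hu hs
  unfold qEh; push_cast
  rw [abs_of_nonneg (prod_nonneg fun i _ => pow_nonneg (by exact_mod_cast (S.all_pos i).le) _)]
  have he'' : ∀ i, S.expn u s i / 2 ≤ c * P.Lallp i * P.S₀p := fun i => (Nat.div_le_self _ _).trans (he i)
  have := hy.prod_hgt_pow_le_p he''
  refine le_trans ?_ this
  refine prod_le_prod (fun i _ => pow_nonneg (by exact_mod_cast (S.all_pos i).le) _) fun i _ => ?_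
  exact pow_le_pow_left₀ (by exact_mod_cast (S.all_pos i).le) (self_le_hgt _) _

end Setup

end Literature.NumberTheory.Transcendental.CW77

end
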